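import Mathlib
import HarnessLib
import Summits.NavierStokesRegularity.NavierStokesRegularity.Theorems.LocalPressureProfileDoorPressureWindowToSlab

/-!
# LocalRuledPressureDoor — stub `stub_windowToEverywhere` of crux `RuledPressureCollapse` (stmt-NavierStokesRegularity-27999)

Route `LocalRuledPressureDoor` (ns-idea-6 LINE g6-1; DIRECTOR-NS #237 (1) key ns-imp-p1 g4).  The birth skeleton
`RuledPressureCollapse_birth.lean` (9b67e5faaad58f62) has two stubs; `stub_ruledDecayVanish` is the landed rung
`localRuledPressureDoor_ruledDecayVanish`; this file proves the other one, `stub_windowToEverywhere` (M), with the statement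
`StubWindowToEverywhere` UNFOLDED (`localRuledPressureDoor_stub_windowToEverywhere`): for a door-class profile, slice by slice, the
translation rule of the similarity pressure `P_t(y) = (−t)·Q[v(t)](√(−t) y)`, `P_t(y + h e) = P_t(y)` for `y` in a ball and
`h ∈ [0, δ]`, holds for ALL `y`.  Mechanism (the skeleton's): for fixed `t, h` the function `H := P_t(· + h e) − P_t` is differentiable
with real-analytic derivative (`differentiable_and_analyticOnNhd_fderiv_profilePressure` composed with the translation) and vanishes on
the open ball, hence everywhere (`eq_of_isOpen_of_fderiv_analyticOnNhd`).

WHAT THIS IS NOT: a lemma about HYPOTHETICAL Type-I zoom profiles; not 0056, not the summit; NS regularity OPEN / not proved.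
-/

noncomputable section

set_option linter.dupNamespace false

namespace Summit.NavierStokesRegularity.NavierStokesRegularity.Theorems

open Set Function Filter Topology Metric
open Literature.Analysis Literature.Analysis.FluidPDE
open Summit.NavierStokesRegularity.NavierStokesRegularity.Theorems.LocalPressureProfileDoorPressureWindowToSlab

/-- **Stub `stub_windowToEverywhere`** (statement `StubWindowToEverywhere` of the birth skeleton, unfolded): window → everywhere
for the translation rule of the similarity pressure, slice by slice. -/
theorem localRuledPressureDoor_stub_windowToEverywhere :
    ∀ (D : ℝ) (v : ℝ → EuclideanSpace ℝ (Fin 3) → EuclideanSpace ℝ (Fin 3)),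
    HasTypeIDecay D v → ContinuousOn (Function.uncurry v) (Set.Iio (0 : ℝ) ×ˢ Set.univ) →
    (∀ s t : ℝ, s < t → t < 0 → ∀ x, v t x = Literature.Analysis.UnboundedOperators.heatExtension (v s) (t - s) x
        - oseenDuhamel 1 s v v t x) →
    (∀ t < 0, VectorCalculus.IsDivFree (v t)) →
    ∀ (e c : EuclideanSpace ℝ (Fin 3)) (r δ : ℝ), 0 < r →
    ∀ t < 0, (∀ y ∈ Metric.ball c r, ∀ h ∈ Set.Icc (0 : ℝ) δ,
        (-t) * pressurePotential (v t) (Real.sqrt (-t) • (y + h • e)) = (-t) * pressurePotential (v t) (Real.sqrt (-t) • y)) →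
      ∀ y, ∀ h ∈ Set.Icc (0 : ℝ) δ,
        (-t) * pressurePotential (v t) (Real.sqrt (-t) • (y + h • e)) = (-t) * pressurePotential (v t) (Real.sqrt (-t) • y) := by
  intro D v hdecay hcont hmild hdiv e c r δ hr t ht hwin y h hh
  -- the similarity-pressure slice and its translate
  obtain ⟨hd, ha⟩ := differentiable_and_analyticOnNhd_fderiv_profilePressure hdecay hcont hmild hdiv ht
  set P : EuclideanSpace ℝ (Fin 3) → ℝ := fun y => (-t) * pressurePotential (v t) (Real.sqrt (-t) • y) with hP
  set H : EuclideanSpace ℝ (Fin 3) → ℝ := fun y => P (y + h • e) - P y with hH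
  have hdT : Differentiable ℝ (fun y : EuclideanSpace ℝ (Fin 3) => P (y + h • e)) :=
    hd.comp (differentiable_id.add (differentiable_const _))
  have hHd : Differentiable ℝ H := hdT.sub hd
  have hHD : AnalyticOnNhd ℝ (fderiv ℝ H) univ := by
    have e1 : fderiv ℝ H = fun y => fderiv ℝ P (y + h • e) - fderiv ℝ P y := by
      funext y
      rw [hH, fderiv_fun_sub (hdT y) (hd y), fderiv_comp_add_right]
    rw [e1]
    intro y _
    have hg : AnalyticAt ℝ (fun y : EuclideanSpace ℝ (Fin 3) => y + h • e) y := analyticAt_id.add analyticAt_const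
    have h1 : AnalyticAt ℝ (fun y : EuclideanSpace ℝ (Fin 3) => fderiv ℝ P (y + h • e)) y :=
      (ha (y + h • e) (mem_univ _)).comp_of_eq hg rfl
    exact h1.sub (ha y (mem_univ _))
  have hc : ∀ y' ∈ ball c r, H y' = H c := by
    intro y' hy'
    have h1 : H y' = 0 := sub_eq_zero.2 (hwin y' hy' h hh)
    have h2 : H c = 0 := sub_eq_zero.2 (hwin c (mem_ball_self hr) h hh)
    rw [h1, h2]
  have hall := eq_of_isOpen_of_fderiv_analyticOnNhd hHd hHD isOpen_ball (mem_ball_self hr) hc y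
  have h2 : H c = 0 := sub_eq_zero.2 (hwin c (mem_ball_self hr) h hh)
  rw [h2] at hall
  exact sub_eq_zero.1 hall

end Summit.NavierStokesRegularity.NavierStokesRegularity.Theorems

end
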